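import Literature.NumberTheory.ComplexMultiplication.CMOrderSuperficialElements
import Mathlib.NumberTheory.RamificationInertia.Basic
import HarnessLib

/-!
# LEMMA 4.3 / COROLLARY 4.4 / THEOREM 4.7 for orders whose singular primes have residue field of size `≥ [K:ℚ]`

[cite: Greither1982TwoGenerator, §2 Thm. 2.1, Cor. 2.2 and Thm. 2.3, pp. 267–268]
[cite: Marseglia2024CMType, §4 Lemma 4.3, Cor. 4.4, Prop. 4.5 and Thm. 4.7, pp. 10–11]
[cite: NeukirchANT1999, Ch. I §8 Prop. (8.2) and the fundamental identity `Σ eᵢfᵢ = n` (8.2), pp. 45–47]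

`CMOrderSuperficialElements` (g29-#6) proves GREITHER THM. 2.1's inequality, MARSEGLIA LEMMA 4.3, COROLLARY 4.4 and
THEOREM 4.7 (i) ⟺ (iii) ⟺ (vi) for an order `S = endOrder (M_μ)` each of whose non-invertible maximal ideals `𝔭`
lies under at most `#(S/𝔭)` maximal ideals of `𝒪_K`.  By the fundamental identity `Σ_𝔓 e_𝔓 f_𝔓 = [K:ℚ]` over the
rational prime `p` below `𝔭` (Mathlib's `Ideal.card_primesOverFinset_le_finrank`), at most `[K:ℚ]` maximal
ideals of `𝒪_K` lie over `𝔭` at all; so the hypothesis holds as soon as **`#(S/𝔭) ≥ [K:ℚ]` at every non-invertible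
`𝔭`** — e.g. whenever every singular prime of `S` lies over a rational prime `p ≥ [K:ℚ]`.  This file records that
arithmetic form.

## What is formalised

* §1 (`𝔯 = endOrder ρ`): `EndOrder.card_le_finrank_of_forall_isMaximal` (a finite set of maximal ideals of `𝒪_K`
  above a maximal `𝔭` of `𝔯` has at most `[K:ℚ]` elements), `EndOrder.card_le_natCard_quotient_of_finrank_le`.
* §2 (`S = endOrder (M_μ)`, hypothesis `[K:ℚ] ≤ #(S/𝔭)` at the non-invertible primes):
  `spanFinrank_coe_le_max_of_finrank_le_natCard` (LEMMA 4.3), `iSup_spanFinrank_coe_eq_spanFinrank_coe_of_finrank_le_natCard`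
  and `iSup_spanFinrank_coe_eq_iSup_finrank_quotient_smul_top_of_finrank_le_natCard` (COR. 4.4),
  `iSup_spanFinrank_coe_eq_spanFinrank_top_quotient_add_one_of_finrank_le_natCard` (THM. 4.7 (iii) ⟺ (vi)),
  `forall_le_and_exists_eq_iSup_spanFinrank_of_finrank_le_natCard` (THM. 4.7 (i) ⟺ (vi)).
-/

noncomputable section

open scoped nonZeroDivisors NumberField
open NumberField Module FractionalIdeal
open Submodule (traceDual)

namespace Literature.NumberTheory.ComplexMultiplication

/-! ## §1 At most `[K:ℚ]` primes of `𝒪_K` lie over a prime of the order -/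

namespace EndOrder

section Count

variable {K : Type} [Field K] [NumberField K]
variable {ι : Type} [Fintype ι] [DecidableEq ι] [Nonempty ι] {ρ : K →ₐ[ℚ] Matrix ι ι ℚ}

/-- **At most `[K:ℚ]` maximal ideals of `𝒪_K` lie over a maximal ideal `𝔭` of the order `𝔯 = endOrder ρ`**: they all
lie over the rational prime `p = char(𝔯/𝔭)`, and `Σ_{𝔓 | p} e_𝔓 f_𝔓 = [K:ℚ]` (the fundamental identity).
[cite: NeukirchANT1999, Ch. I §8 Prop. (8.2) («fundamental identity»), p. 46] [cite: Greither1982TwoGenerator, §2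
Thm. 2.1 (proof: «`mS = ∏ᵢ₌₁ʳ nᵢ^{eᵢ}`»), p. 267] -/
theorem card_le_finrank_of_forall_isMaximal {𝔭 : Ideal (endOrder ρ)} [h𝔭 : 𝔭.IsMaximal]
    (𝒬 : Finset (Ideal (𝓞 K))) (h𝒬 : ∀ Q ∈ 𝒬, Q.IsMaximal ∧ 𝔭.map (toRingOfIntegers ρ) ≤ Q) :
    𝒬.card ≤ Module.finrank ℚ K := by
  classical
  have h0 : 𝔭 ≠ ⊥ := Ring.ne_bot_of_isMaximal_of_not_isField h𝔭 not_isField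
  haveI := CMTypeLattice.finite_quotient_endOrder ρ h0
  -- the rational prime `p` below `𝔭`
  obtain ⟨p, hp⟩ := CharP.exists (endOrder ρ ⧸ 𝔭)
  have hprime : p.Prime := CharP.char_is_prime (endOrder ρ ⧸ 𝔭) p
  have hp𝔭 : (p : endOrder ρ) ∈ 𝔭 := by
    rw [← Ideal.Quotient.eq_zero_iff_mem, map_natCast]
    exact CharP.cast_eq_zero _ p
  have hpℤ0 : (Ideal.span {(p : ℤ)} : Ideal ℤ) ≠ ⊥ := by
    rw [Ne, Ideal.span_singleton_eq_bot]
    exact_mod_cast hprime.ne_zero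
  haveI hpℤ : (Ideal.span {(p : ℤ)} : Ideal ℤ).IsMaximal :=
    ((Ideal.span_singleton_prime (by exact_mod_cast hprime.ne_zero)).2
      (Nat.prime_iff_prime_int.1 hprime)).isMaximal hpℤ0
  -- every `Q ∈ 𝒬` lies over `pℤ`
  have hsub : 𝒬 ⊆ IsDedekindDomain.primesOverFinset (Ideal.span {(p : ℤ)}) (𝓞 K) := fun Q hQ ↦ by
    obtain ⟨hQmax, hQ𝔭⟩ := h𝒬 Q hQ
    have hpQ : (p : 𝓞 K) ∈ Q := by
      have h := hQ𝔭 (Ideal.mem_map_of_mem (toRingOfIntegers ρ) hp𝔭)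
      rwa [map_natCast] at h
    have hle : Ideal.span {(p : ℤ)} ≤ Q.under ℤ := by
      rw [Ideal.span_singleton_le_iff_mem, Ideal.under_def, Ideal.mem_comap, map_natCast]
      exact hpQ
    have hover : Q.LiesOver (Ideal.span {(p : ℤ)}) :=
      ⟨hpℤ.eq_of_le (Ideal.comap_ne_top _ hQmax.ne_top) hle⟩
    exact (IsDedekindDomain.mem_primesOverFinset_iff hpℤ0 (𝓞 K)).2 ⟨hQmax.isPrime, hover⟩
  exact (Finset.card_le_card hsub).trans (Ideal.card_primesOverFinset_le_finrank (𝓞 K) ℚ K hpℤ0)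

/-- **Hence, if `#(𝔯/𝔭) ≥ [K:ℚ]`, at most `#(𝔯/𝔭)` primes of `𝒪_K` lie over `𝔭`** — the hypothesis of
`CMOrderSuperficialElements`. [cite: Greither1982TwoGenerator, §2 Thm. 2.1 (proof), p. 267] -/
theorem card_le_natCard_quotient_of_finrank_le {𝔭 : Ideal (endOrder ρ)} [h𝔭 : 𝔭.IsMaximal]
    (hdeg : Module.finrank ℚ K ≤ Nat.card (endOrder ρ ⧸ 𝔭))
    (𝒬 : Finset (Ideal (𝓞 K))) (h𝒬 : ∀ Q ∈ 𝒬, Q.IsMaximal ∧ 𝔭.map (toRingOfIntegers ρ) ≤ Q) :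
    𝒬.card ≤ Nat.card (endOrder ρ ⧸ 𝔭) :=
  (card_le_finrank_of_forall_isMaximal 𝒬 h𝒬).trans hdeg

end Count

end EndOrder

/-! ## §2 LEMMA 4.3, COROLLARY 4.4 and THEOREM 4.7 when `#(S/𝔭) ≥ [K:ℚ]` at the non-invertible primes -/

namespace CMTypeLattice

section Consequences

variable {K : Type} [Field K] [NumberField K]
variable {ι : Type} [Fintype ι] [DecidableEq ι] (μ : Basis ι ℚ K) [Nonempty ι]
variable [IsFractionRing (endOrder (Algebra.leftMulMatrix μ)) K]

/-- **MARSEGLIA 2024 LEMMA 4.3 «`gens(S) ≤ max{2, gens_S(𝒪_K)}`», ideal by ideal, for an order with `#(S/𝔭) ≥ [K:ℚ]`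
at every non-invertible prime `𝔭`** (GREITHER COR. 2.2). [cite: Marseglia2024CMType, §4 Lemma 4.3, p. 10]
[cite: Greither1982TwoGenerator, §2 Cor. 2.2, p. 268] -/
theorem spanFinrank_coe_le_max_of_finrank_le_natCard {M : FractionalIdeal (endOrder (Algebra.leftMulMatrix μ))⁰ K}
    (hMO : (M : Set K) = (algebraMap (𝓞 K) K).range)
    (hN : ∀ 𝔭 : MaximalSpectrum (endOrder (Algebra.leftMulMatrix μ)),
      ¬ IsUnit (𝔭.asIdeal : FractionalIdeal (endOrder (Algebra.leftMulMatrix μ))⁰ K) →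
      Module.finrank ℚ K ≤ Nat.card (endOrder (Algebra.leftMulMatrix μ) ⧸ 𝔭.asIdeal))
    {I : FractionalIdeal (endOrder (Algebra.leftMulMatrix μ))⁰ K} (hI : I ≠ 0) :
    (I : Submodule (endOrder (Algebra.leftMulMatrix μ)) K).spanFinrank ≤
      max 2 (M : Submodule (endOrder (Algebra.leftMulMatrix μ)) K).spanFinrank :=
  spanFinrank_coe_le_max_of_card_le μ hMO (fun 𝔭 hu ↦ by
    haveI := 𝔭.isMaximal
    exact EndOrder.card_le_natCard_quotient_of_finrank_le (hN 𝔭 hu)) hI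

/-- **MARSEGLIA 2024 COROLLARY 4.4 «`gens(S) = gens_S(𝒪_K)`» for a non-maximal order with `#(S/𝔭) ≥ [K:ℚ]` at every
non-invertible prime `𝔭`.** [cite: Marseglia2024CMType, §4 Cor. 4.4, p. 10] [cite: Greither1982TwoGenerator, §2
Cor. 2.2, p. 268] -/
theorem iSup_spanFinrank_coe_eq_spanFinrank_coe_of_finrank_le_natCard
    {M : FractionalIdeal (endOrder (Algebra.leftMulMatrix μ))⁰ K}
    (hMO : (M : Set K) = (algebraMap (𝓞 K) K).range)
    (hS : ∃ a : 𝓞 K, (a : K) ∉ endOrder (Algebra.leftMulMatrix μ))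
    (hN : ∀ 𝔭 : MaximalSpectrum (endOrder (Algebra.leftMulMatrix μ)),
      ¬ IsUnit (𝔭.asIdeal : FractionalIdeal (endOrder (Algebra.leftMulMatrix μ))⁰ K) →
      Module.finrank ℚ K ≤ Nat.card (endOrder (Algebra.leftMulMatrix μ) ⧸ 𝔭.asIdeal)) :
    ⨆ I : {I : FractionalIdeal (endOrder (Algebra.leftMulMatrix μ))⁰ K // I ≠ 0},
        ((I : FractionalIdeal (endOrder (Algebra.leftMulMatrix μ))⁰ K) :
          Submodule (endOrder (Algebra.leftMulMatrix μ)) K).spanFinrank =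
      (M : Submodule (endOrder (Algebra.leftMulMatrix μ)) K).spanFinrank :=
  iSup_spanFinrank_coe_eq_spanFinrank_coe_of_card_le μ hMO hS fun 𝔭 hu ↦ by
    haveI := 𝔭.isMaximal
    exact EndOrder.card_le_natCard_quotient_of_finrank_le (hN 𝔭 hu)

/-- **COROLLARY 4.4 in full, `gens(S) = max_𝔭 dim_{S/𝔭} 𝒪_K/𝔭𝒪_K`, under `#(S/𝔭) ≥ [K:ℚ]` at the non-invertible
primes.** [cite: Marseglia2024CMType, §4 Cor. 4.4, p. 10] -/
theorem iSup_spanFinrank_coe_eq_iSup_finrank_quotient_smul_top_of_finrank_le_natCard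
    {M : FractionalIdeal (endOrder (Algebra.leftMulMatrix μ))⁰ K}
    (hMO : (M : Set K) = (algebraMap (𝓞 K) K).range)
    (hS : ∃ a : 𝓞 K, (a : K) ∉ endOrder (Algebra.leftMulMatrix μ))
    (hN : ∀ 𝔭 : MaximalSpectrum (endOrder (Algebra.leftMulMatrix μ)),
      ¬ IsUnit (𝔭.asIdeal : FractionalIdeal (endOrder (Algebra.leftMulMatrix μ))⁰ K) →
      Module.finrank ℚ K ≤ Nat.card (endOrder (Algebra.leftMulMatrix μ) ⧸ 𝔭.asIdeal)) :
    ⨆ I : {I : FractionalIdeal (endOrder (Algebra.leftMulMatrix μ))⁰ K // I ≠ 0},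
        ((I : FractionalIdeal (endOrder (Algebra.leftMulMatrix μ))⁰ K) :
          Submodule (endOrder (Algebra.leftMulMatrix μ)) K).spanFinrank =
      ⨆ 𝔭 : MaximalSpectrum (endOrder (Algebra.leftMulMatrix μ)),
        Module.finrank (endOrder (Algebra.leftMulMatrix μ) ⧸ 𝔭.asIdeal)
          (↥(M : Submodule (endOrder (Algebra.leftMulMatrix μ)) K) ⧸
            (𝔭.asIdeal • ⊤ : Submodule (endOrder (Algebra.leftMulMatrix μ))
              (M : Submodule (endOrder (Algebra.leftMulMatrix μ)) K))) :=
  iSup_spanFinrank_coe_eq_iSup_finrank_quotient_smul_top_of_card_le μ hMO hS fun 𝔭 hu ↦ by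
    haveI := 𝔭.isMaximal
    exact EndOrder.card_le_natCard_quotient_of_finrank_le (hN 𝔭 hu)

/-- **MARSEGLIA 2024 THEOREM 4.7, (iii) ⟺ (vi) «`gens(S) = gens_S(𝒪_K/S) + 1`», under `#(S/𝔭) ≥ [K:ℚ]` at the
non-invertible primes.** [cite: Marseglia2024CMType, §4 Thm. 4.7 ((iii) ⟺ (vi)), p. 11] -/
theorem iSup_spanFinrank_coe_eq_spanFinrank_top_quotient_add_one_of_finrank_le_natCard
    {M : FractionalIdeal (endOrder (Algebra.leftMulMatrix μ))⁰ K}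
    (hMO : (M : Set K) = (algebraMap (𝓞 K) K).range)
    (hS : ∃ a : 𝓞 K, (a : K) ∉ endOrder (Algebra.leftMulMatrix μ))
    (hN : ∀ 𝔭 : MaximalSpectrum (endOrder (Algebra.leftMulMatrix μ)),
      ¬ IsUnit (𝔭.asIdeal : FractionalIdeal (endOrder (Algebra.leftMulMatrix μ))⁰ K) →
      Module.finrank ℚ K ≤ Nat.card (endOrder (Algebra.leftMulMatrix μ) ⧸ 𝔭.asIdeal)) :
    ⨆ I : {I : FractionalIdeal (endOrder (Algebra.leftMulMatrix μ))⁰ K // I ≠ 0},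
        ((I : FractionalIdeal (endOrder (Algebra.leftMulMatrix μ))⁰ K) :
          Submodule (endOrder (Algebra.leftMulMatrix μ)) K).spanFinrank =
      (⊤ : Submodule (endOrder (Algebra.leftMulMatrix μ))
        ((M : Submodule (endOrder (Algebra.leftMulMatrix μ)) K) ⧸
          (1 : Submodule (endOrder (Algebra.leftMulMatrix μ)) K).comap
            (M : Submodule (endOrder (Algebra.leftMulMatrix μ)) K).subtype)).spanFinrank + 1 :=
  iSup_spanFinrank_coe_eq_spanFinrank_top_quotient_add_one_of_card_le μ hMO hS fun 𝔭 hu ↦ by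
    haveI := 𝔭.isMaximal
    exact EndOrder.card_le_natCard_quotient_of_finrank_le (hN 𝔭 hu)

/-- **MARSEGLIA 2024 THEOREM 4.7, (i) ⟺ (vi) «`gens(S) = 1 + max_{T ∈ 𝒮} type(T)`», under `#(S/𝔭) ≥ [K:ℚ]` at the
non-invertible primes.** [cite: Marseglia2024CMType, §4 Thm. 4.7 ((i) ⟺ (vi)), p. 11] -/
theorem forall_le_and_exists_eq_iSup_spanFinrank_of_finrank_le_natCard
    {M : FractionalIdeal (endOrder (Algebra.leftMulMatrix μ))⁰ K}
    (hMO : (M : Set K) = (algebraMap (𝓞 K) K).range)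
    (hS : ∃ a : 𝓞 K, (a : K) ∉ endOrder (Algebra.leftMulMatrix μ))
    (hN : ∀ 𝔭 : MaximalSpectrum (endOrder (Algebra.leftMulMatrix μ)),
      ¬ IsUnit (𝔭.asIdeal : FractionalIdeal (endOrder (Algebra.leftMulMatrix μ))⁰ K) →
      Module.finrank ℚ K ≤ Nat.card (endOrder (Algebra.leftMulMatrix μ) ⧸ 𝔭.asIdeal)) :
    (∀ ν : Basis ι ℚ K, endOrder (Algebra.leftMulMatrix μ) ≤ endOrder (Algebra.leftMulMatrix ν) →
      ∀ T' : FractionalIdeal (endOrder (Algebra.leftMulMatrix ν))⁰ K,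
        (T' : Submodule (endOrder (Algebra.leftMulMatrix ν)) K) =
          traceDual ℤ ℚ ((1 : FractionalIdeal (endOrder (Algebra.leftMulMatrix ν))⁰ K) :
            Submodule (endOrder (Algebra.leftMulMatrix ν)) K) →
        (⨆ 𝔔 : MaximalSpectrum (endOrder (Algebra.leftMulMatrix ν)),
            Module.finrank (endOrder (Algebra.leftMulMatrix ν) ⧸ 𝔔.asIdeal)
              ((T' : Submodule (endOrder (Algebra.leftMulMatrix ν)) K) ⧸
                (𝔔.asIdeal • ⊤ : Submodule (endOrder (Algebra.leftMulMatrix ν))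
                  (T' : Submodule (endOrder (Algebra.leftMulMatrix ν)) K)))) + 1 ≤
          ⨆ I : {I : FractionalIdeal (endOrder (Algebra.leftMulMatrix μ))⁰ K // I ≠ 0},
            ((I : FractionalIdeal (endOrder (Algebra.leftMulMatrix μ))⁰ K) :
              Submodule (endOrder (Algebra.leftMulMatrix μ)) K).spanFinrank) ∧
    ∃ ν : Basis ι ℚ K, endOrder (Algebra.leftMulMatrix μ) ≤ endOrder (Algebra.leftMulMatrix ν) ∧
      ∀ T' : FractionalIdeal (endOrder (Algebra.leftMulMatrix ν))⁰ K,
        (T' : Submodule (endOrder (Algebra.leftMulMatrix ν)) K) =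
          traceDual ℤ ℚ ((1 : FractionalIdeal (endOrder (Algebra.leftMulMatrix ν))⁰ K) :
            Submodule (endOrder (Algebra.leftMulMatrix ν)) K) →
        (⨆ 𝔔 : MaximalSpectrum (endOrder (Algebra.leftMulMatrix ν)),
            Module.finrank (endOrder (Algebra.leftMulMatrix ν) ⧸ 𝔔.asIdeal)
              ((T' : Submodule (endOrder (Algebra.leftMulMatrix ν)) K) ⧸
                (𝔔.asIdeal • ⊤ : Submodule (endOrder (Algebra.leftMulMatrix ν))
                  (T' : Submodule (endOrder (Algebra.leftMulMatrix ν)) K)))) + 1 =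
          ⨆ I : {I : FractionalIdeal (endOrder (Algebra.leftMulMatrix μ))⁰ K // I ≠ 0},
            ((I : FractionalIdeal (endOrder (Algebra.leftMulMatrix μ))⁰ K) :
              Submodule (endOrder (Algebra.leftMulMatrix μ)) K).spanFinrank :=
  forall_le_and_exists_eq_iSup_spanFinrank_of_card_le μ hMO hS fun 𝔭 hu ↦ by
    haveI := 𝔭.isMaximal
    exact EndOrder.card_le_natCard_quotient_of_finrank_le (hN 𝔭 hu)

end Consequences

end CMTypeLattice

end Literature.NumberTheory.ComplexMultiplication
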